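import Mathlib.NumberTheory.Zsqrtd.Basic
import Mathlib.NumberTheory.NumberField.Basic
import Mathlib.NumberTheory.LegendreSymbol.Basic
import Mathlib.RingTheory.Norm.Transitivity
import Mathlib.FieldTheory.IntermediateField.Adjoin.Basic
import Mathlib.Data.Rat.Lemmas
import HarnessLib

/-!
# Weil-type family coverage — THEOREM L (i) at the census levels `35`, `45` made ELEMENTARY: `−1` is not a norm
# from a number field containing `√5` and `√(q(5+√5)/2)`, `q = 3, 7` (a `q`-adic obstruction, no class field theory)

research route conditional on HC_CM; not a corollary; Q11.4-sentence-2 already refuted in dim ≥ 3.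

Ring 2, WEIL-TYPE FAMILY-COVERAGE CENSUS (`HOME/WEIL-FAMILY-COVERAGE.md` `## b01`, blocks b01.28 THEOREM L (i) «no unit
of `ℚ(ζ_M)⁺` has norm `−1`», b01.34 (D), b01.36 (D)/(E) «the four NO rows at `35/45` remain modulo THEOREM L (i)»;
owner ring2-b01), part 30 of the `Ring2WeilCoverage*` series.  Part 8 (`…RealQuadraticUnitNorm`) discharged
THEOREM L (i) wherever `ℚ(ζ_M)⁺ ⊇ ℚ(√D)`, `q ≡ 3 (4)` prime, `q ∥ D`; at `M = 35, 45` the only real quadratic subfield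
is `ℚ(√5)` (fundamental unit of norm `−1`) and that route fails.  THIS FILE uses the next layer of the tower —
`ℚ(ζ₃₅)⁺ ⊇ ℚ(√(7(5+√5)/2))`, `ℚ(ζ₄₅)⁺ ⊇ ℚ(√(3(5+√5)/2)) = ℚ(ζ₁₅)⁺` (real cyclic quartic fields of conductor
`35`, `15`) — and a `q`-ADIC OBSTRUCTION (`q = 7`, resp. `3`, is inert in `ℚ(√5)`, `−1` is a non-residue mod `q`):
* §1 (`ℤ[√5] = ℤ√5`, Mathlib `Zsqrtd`; `p ≡ 3 (mod 4)` prime, `5` a non-residue mod `p`, so `p` is a prime element: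
  `p ∣ N(x) ⇒ p ∣ x`, `p ∣ xy ⇒ p ∣ x ∨ p ∣ y`; `p ∤ γ`): **`norm_ne_neg_pow_four`: `N(A² − pγB²) ≠ −D⁴`**
  (`A, B ∈ ℤ[√5]`, `D ≠ 0`; descent on `|D|`: `p ∤ A` ⇒ `N ≡ N(A)² ≢ −□ (mod p)`; `p ∣ A, p ∤ B` ⇒ `p² ∥ N = −D⁴`;
  `p ∣ A, B` ⇒ `p ∣ D`, descend);
* §2 `rat_core` (denominators cleared; `4β = q(10 + 2√5)`, `q ∤ 10 + 2√5`): `N_{ℚ(√5)/ℚ}(a² − βc²) ≠ −1`,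
  `β = q(5+√5)/2`, for all `a, c ∈ ℚ(√5)`;
* §3 (quadratic extension `E/F`, basis `(1, w)`, `w² = β ∈ F`): `exists_coords`, **`norm_quadratic`:
  `N_{E/F}(a + cw) = a² − βc²`** (`Algebra.norm_eq_matrix_det`), `finrank_adjoin_eq_two`;
* §4 **`norm_ne_neg_one`: a number field `L ∋ s, w`, `s² = 5`, `2w² = q(5 + s)` has `N_{L/ℚ}(x) ≠ −1` for EVERY
  `x ∈ L`** (`N_{L/ℚ} = N_{ℚ(s)/ℚ} ∘ N_{ℚ(s,w)/ℚ(s)} ∘ N_{L/ℚ(s,w)}`, Mathlib `Algebra.norm_norm`; `w ∉ ℚ(s)` as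
  `N(β) = 5q²` is not a square).  Part 31 puts `s, w` in `ℚ(ζ₃₅)⁺, ℚ(ζ₄₅)⁺` and drops `hN` from part 29's rows.

HONEST FRAMING: elementary algebraic number theory; THEOREM L (i) for general non-prime-power `M` (Hasse, class
field theory) is NOT proved — only what the levels `35, 45` need; nothing here mentions Hodge classes, `W_K` or HC;
`HC_CM` is used nowhere.  No `def`, no named fact, no `sorry`.  References: [folklore] (local obstruction to `−1`
being a norm from a cyclic quartic field; norm forms); census b01.28, b01.34 (D), b01.36 (E) (seat-derived).
-/

noncomputable section

open Module Polynomial IntermediateField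

namespace Summit.HodgeConjecture.Ring2WeilCoverage.QuarticNormObstruction

/-! ### §1 The arithmetic core in `ℤ[√5]` -/

/-- `N(p·z) = p²·N(z)` in `ℤ[√5]`.
research route conditional on HC_CM; not a corollary; Q11.4-sentence-2 already refuted in dim ≥ 3. [folklore] -/
theorem norm_natCast_mul (p : ℕ) (z : ℤ√5) : ((p : ℤ√5) * z).norm = (p : ℤ) ^ 2 * z.norm := by
  rw [Zsqrtd.norm_mul, Zsqrtd.norm_natCast]; ring

/-- **`p ∣ N(x) ⇒ p ∣ x` in `ℤ[√5]`** when `5` is a non-residue mod `p` (hypothesis `h5`: `u² = 5v²` in `ℤ/p` forces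
`u = v = 0`): `x = u + v√5`, `p ∣ u² − 5v²` gives `u ≡ v ≡ 0`.
research route conditional on HC_CM; not a corollary; Q11.4-sentence-2 already refuted in dim ≥ 3. [folklore] -/
theorem natCast_dvd_of_dvd_norm {p : ℕ} [NeZero p] (h5 : ∀ u v : ZMod p, u ^ 2 = 5 * v ^ 2 → u = 0 ∧ v = 0)
    {x : ℤ√5} (h : (p : ℤ) ∣ x.norm) : (p : ℤ√5) ∣ x := by
  have h' : ((x.re : ℤ) : ZMod p) ^ 2 = 5 * ((x.im : ℤ) : ZMod p) ^ 2 := by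
    have h0 : ((x.norm : ℤ) : ZMod p) = 0 := (ZMod.intCast_zmod_eq_zero_iff_dvd _ _).mpr h
    rw [Zsqrtd.norm_def] at h0
    push_cast at h0
    linear_combination h0
  obtain ⟨hre, him⟩ := h5 _ _ h'
  rw [← Int.cast_natCast, Zsqrtd.intCast_dvd]
  exact ⟨(ZMod.intCast_zmod_eq_zero_iff_dvd _ _).mp hre, (ZMod.intCast_zmod_eq_zero_iff_dvd _ _).mp him⟩

/-- **`p` is a prime element of `ℤ[√5]`** (`p` a rational prime, `5` a non-residue mod `p`): `p ∣ xy ⇒ p ∣ x ∨ p ∣ y`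
(`p ∣ xy ⇒ p² ∣ N(x)N(y) ⇒ p ∣ N(x)` or `p ∣ N(y)`).
research route conditional on HC_CM; not a corollary; Q11.4-sentence-2 already refuted in dim ≥ 3. [folklore] -/
theorem natCast_dvd_or_dvd {p : ℕ} (hp : p.Prime) (h5 : ∀ u v : ZMod p, u ^ 2 = 5 * v ^ 2 → u = 0 ∧ v = 0)
    {x y : ℤ√5} (h : (p : ℤ√5) ∣ x * y) : (p : ℤ√5) ∣ x ∨ (p : ℤ√5) ∣ y := by
  haveI : NeZero p := ⟨hp.ne_zero⟩
  have hpZ : Prime (p : ℤ) := Nat.prime_iff_prime_int.mp hp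
  obtain ⟨z, hz⟩ := h
  have h1 : (p : ℤ) ∣ x.norm * y.norm := by
    refine ⟨p * z.norm, ?_⟩
    rw [← Zsqrtd.norm_mul, hz, norm_natCast_mul]; ring
  rcases hpZ.dvd_or_dvd h1 with h2 | h2
  · exact Or.inl (natCast_dvd_of_dvd_norm h5 h2)
  · exact Or.inr (natCast_dvd_of_dvd_norm h5 h2)

/-- `N(x + p·z) ≡ N(x) (mod p)`.
research route conditional on HC_CM; not a corollary; Q11.4-sentence-2 already refuted in dim ≥ 3. [folklore] -/
theorem cast_norm_add_natCast_mul (p : ℕ) (x z : ℤ√5) :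
    (((x + p * z).norm : ℤ) : ZMod p) = ((x.norm : ℤ) : ZMod p) := by
  simp only [Zsqrtd.norm_def, Zsqrtd.re_add, Zsqrtd.im_add, Zsqrtd.re_mul, Zsqrtd.im_mul,
    Zsqrtd.re_natCast, Zsqrtd.im_natCast]
  push_cast
  simp only [ZMod.natCast_self, zero_mul, add_zero]

/-- **THE DESCENT**: for a prime `p ≡ 3 (mod 4)` with `5` a non-residue mod `p`, and `γ ∈ ℤ[√5]` with `p ∤ γ`,
`N(A² − pγB²) ≠ −D⁴` for all `A, B ∈ ℤ[√5]` and every integer `D ≠ 0`.  (Strong induction on `|D|`: `p ∤ A` ⇒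
`N ≡ N(A)² ≢ −□ (mod p)` as `−1` is a non-residue; `p ∣ A, p ∤ B` ⇒ `p² ∥ N = −D⁴`; `p ∣ A, p ∣ B` ⇒ `p ∣ D`, descend.)
research route conditional on HC_CM; not a corollary; Q11.4-sentence-2 already refuted in dim ≥ 3. [folklore] -/
theorem norm_ne_neg_pow_four {p : ℕ} (hp : p.Prime) (hp4 : p % 4 = 3)
    (h5 : ∀ u v : ZMod p, u ^ 2 = 5 * v ^ 2 → u = 0 ∧ v = 0) {γ : ℤ√5} (hγ : ¬ (p : ℤ√5) ∣ γ)
    (A B : ℤ√5) {D : ℤ} (hD : D ≠ 0) : (A * A - p * γ * (B * B)).norm ≠ -D ^ 4 := by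
  haveI := Fact.mk hp
  haveI : NeZero p := ⟨hp.ne_zero⟩
  have hpZ : Prime (p : ℤ) := Nat.prime_iff_prime_int.mp hp
  have hp0 : (p : ℤ) ≠ 0 := by exact_mod_cast hp.ne_zero
  suffices H : ∀ n : ℕ, ∀ (A B : ℤ√5) (D : ℤ), D.natAbs = n → D ≠ 0 →
      (A * A - p * γ * (B * B)).norm ≠ -D ^ 4 from H _ A B D rfl hD
  intro n
  refine Nat.strong_induction_on n ?_
  intro n ih A B D hn hD hE
  by_cases hA : (p : ℤ√5) ∣ A
  · obtain ⟨A', rfl⟩ := hA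
    by_cases hB : (p : ℤ√5) ∣ B
    · obtain ⟨B', rfl⟩ := hB
      have hC : (p : ℤ√5) * A' * ((p : ℤ√5) * A') - p * γ * ((p : ℤ√5) * B' * ((p : ℤ√5) * B')) =
          (p : ℤ√5) * ((p : ℤ√5) * (A' * A' - p * γ * (B' * B'))) := by ring
      rw [hC, norm_natCast_mul, norm_natCast_mul] at hE
      have h1 : (p : ℤ) ∣ D ^ 4 :=
        ⟨-((p : ℤ) ^ 3 * (A' * A' - p * γ * (B' * B')).norm), by linear_combination hE⟩
      obtain ⟨D', rfl⟩ := hpZ.dvd_of_dvd_pow h1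
      have hD' : D' ≠ 0 := by rintro rfl; exact hD (mul_zero _)
      have hE' : (A' * A' - p * γ * (B' * B')).norm = -D' ^ 4 := by
        apply mul_left_cancel₀ (pow_ne_zero 4 hp0)
        linear_combination hE
      refine ih D'.natAbs ?_ A' B' D' rfl hD' hE'
      rw [← hn, Int.natAbs_mul, Int.natAbs_natCast]
      nlinarith [Int.natAbs_pos.mpr hD', hp.two_le]
    · set C₁ : ℤ√5 := (p : ℤ√5) * (A' * A') - γ * (B * B) with hC₁
      have hC : (p : ℤ√5) * A' * ((p : ℤ√5) * A') - p * γ * (B * B) = (p : ℤ√5) * C₁ := by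
        rw [hC₁]; ring
      rw [hC, norm_natCast_mul] at hE
      have hC₁p : ¬ (p : ℤ√5) ∣ C₁ := by
        intro h
        have h2 : (p : ℤ√5) ∣ γ * (B * B) := by
          have : γ * (B * B) = (p : ℤ√5) * (A' * A') - C₁ := by rw [hC₁]; ring
          rw [this]
          exact dvd_sub (dvd_mul_right _ _) h
        rcases natCast_dvd_or_dvd hp h5 h2 with h3 | h3
        · exact hγ h3
        · rcases natCast_dvd_or_dvd hp h5 h3 with h4 | h4 <;> exact hB h4
      have hNp : ¬ (p : ℤ) ∣ C₁.norm := fun h => hC₁p (natCast_dvd_of_dvd_norm h5 h)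
      have h1 : (p : ℤ) ∣ D ^ 4 := ⟨-((p : ℤ) * C₁.norm), by linear_combination hE⟩
      obtain ⟨D', rfl⟩ := hpZ.dvd_of_dvd_pow h1
      apply hNp
      refine ⟨-((p : ℤ) * D' ^ 4), ?_⟩
      apply mul_left_cancel₀ (pow_ne_zero 2 hp0)
      linear_combination hE
  · have hmod : (((A * A - p * γ * (B * B)).norm : ℤ) : ZMod p) = (((A * A).norm : ℤ) : ZMod p) := by
      have : A * A - p * γ * (B * B) = A * A + p * (-(γ * (B * B))) := by ring
      rw [this, cast_norm_add_natCast_mul]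
    rw [hE, Zsqrtd.norm_mul] at hmod
    push_cast at hmod
    have hA0 : ((A.norm : ℤ) : ZMod p) ≠ 0 := by
      intro h
      exact hA (natCast_dvd_of_dvd_norm h5 ((ZMod.intCast_zmod_eq_zero_iff_dvd _ _).mp h))
    have hsq : IsSquare (-1 : ZMod p) := by
      refine ⟨(D : ZMod p) ^ 2 * ((A.norm : ℤ) : ZMod p)⁻¹, ?_⟩
      calc (-1 : ZMod p) = -((((A.norm : ℤ) : ZMod p)) * ((A.norm : ℤ) : ZMod p)⁻¹) *
            ((((A.norm : ℤ) : ZMod p)) * ((A.norm : ℤ) : ZMod p)⁻¹) := by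
              rw [mul_inv_cancel₀ hA0]; ring
        _ = (D : ZMod p) ^ 2 * ((A.norm : ℤ) : ZMod p)⁻¹ * ((D : ZMod p) ^ 2 * ((A.norm : ℤ) : ZMod p)⁻¹) := by
              linear_combination (((A.norm : ℤ) : ZMod p)⁻¹ * ((A.norm : ℤ) : ZMod p)⁻¹) * hmod
    exact (ZMod.exists_sq_eq_neg_one_iff (p := p)).mp hsq hp4

/-! ### §2 Clearing denominators: the statement over `ℚ(√5)` in coordinates -/

/-- **Rational core**: `q ≡ 3 (mod 4)` prime, `5` a non-residue mod `q`, `q` odd; `a = a₁ + a₂√5`, `c = c₁ + c₂√5`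
rational, `β = q(5 + √5)/2`, `a² − βc² = Y₁ + Y₂√5`: then `N(a² − βc²) = Y₁² − 5Y₂² ≠ −1` (common denominator
`d = 2·∏ den`: `d²(a² − βc²) = A² − q(10+2√5)B²`, `A = d·a`, `B = (d/2)·c ∈ ℤ[√5]`; §1 with `γ = 10 + 2√5`).
research route conditional on HC_CM; not a corollary; Q11.4-sentence-2 already refuted in dim ≥ 3. [folklore] -/
theorem rat_core {q : ℕ} (hq : q.Prime) (hq4 : q % 4 = 3)
    (h5 : ∀ u v : ZMod q, u ^ 2 = 5 * v ^ 2 → u = 0 ∧ v = 0) (hq2 : ¬ q ∣ 2)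
    (a₁ a₂ c₁ c₂ Y₁ Y₂ : ℚ)
    (hY₁ : Y₁ = a₁ ^ 2 + 5 * a₂ ^ 2 - (q : ℚ) / 2 * (5 * (c₁ ^ 2 + 5 * c₂ ^ 2) + 5 * (2 * c₁ * c₂)))
    (hY₂ : Y₂ = 2 * a₁ * a₂ - (q : ℚ) / 2 * ((c₁ ^ 2 + 5 * c₂ ^ 2) + 5 * (2 * c₁ * c₂))) :
    Y₁ ^ 2 - 5 * Y₂ ^ 2 ≠ -1 := by
  intro h
  rw [hY₁, hY₂] at h
  -- common denominator and integral coordinates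
  set d : ℕ := 2 * a₁.den * a₂.den * c₁.den * c₂.den with hd
  have hd0 : d ≠ 0 := by
    rw [hd]
    exact Nat.mul_ne_zero (Nat.mul_ne_zero (Nat.mul_ne_zero (Nat.mul_ne_zero two_ne_zero a₁.den_nz)
      a₂.den_nz) c₁.den_nz) c₂.den_nz
  set A₁ : ℤ := a₁.num * ((2 * a₂.den * c₁.den * c₂.den : ℕ) : ℤ) with hA₁
  set A₂ : ℤ := a₂.num * ((2 * a₁.den * c₁.den * c₂.den : ℕ) : ℤ) with hA₂
  set B₁ : ℤ := c₁.num * ((a₁.den * a₂.den * c₂.den : ℕ) : ℤ) with hB₁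
  set B₂ : ℤ := c₂.num * ((a₁.den * a₂.den * c₁.den : ℕ) : ℤ) with hB₂
  have hA₁' : (A₁ : ℚ) = d * a₁ := by
    rw [hA₁, hd]; push_cast; rw [← Rat.mul_den_eq_num a₁]; ring
  have hA₂' : (A₂ : ℚ) = d * a₂ := by
    rw [hA₂, hd]; push_cast; rw [← Rat.mul_den_eq_num a₂]; ring
  have hB₁' : 2 * (B₁ : ℚ) = d * c₁ := by
    rw [hB₁, hd]; push_cast; rw [← Rat.mul_den_eq_num c₁]; ring
  have hB₂' : 2 * (B₂ : ℚ) = d * c₂ := by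
    rw [hB₂, hd]; push_cast; rw [← Rat.mul_den_eq_num c₂]; ring
  -- the integral equation `N(A² − q(10+2√5)B²) = −d⁴`
  have key : ((⟨A₁, A₂⟩ : ℤ√5) * ⟨A₁, A₂⟩ - q * ⟨10, 2⟩ * ((⟨B₁, B₂⟩ : ℤ√5) * ⟨B₁, B₂⟩)).norm =
      -(d : ℤ) ^ 4 := by
    have e : ((((⟨A₁, A₂⟩ : ℤ√5) * ⟨A₁, A₂⟩ - q * ⟨10, 2⟩ * ((⟨B₁, B₂⟩ : ℤ√5) * ⟨B₁, B₂⟩)).norm : ℤ) : ℚ)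
        = ((-(d : ℤ) ^ 4 : ℤ) : ℚ) := by
      simp only [Zsqrtd.norm_def, Zsqrtd.re_sub, Zsqrtd.im_sub, Zsqrtd.re_mul, Zsqrtd.im_mul,
        Zsqrtd.re_natCast, Zsqrtd.im_natCast]
      push_cast
      have eB₁ : (B₁ : ℚ) = d * c₁ / 2 := by linear_combination hB₁' / 2
      have eB₂ : (B₂ : ℚ) = d * c₂ / 2 := by linear_combination hB₂' / 2
      rw [hA₁', hA₂', eB₁, eB₂]
      linear_combination (d : ℚ) ^ 4 * h
    exact_mod_cast e
  have hγ : ¬ (q : ℤ√5) ∣ (⟨10, 2⟩ : ℤ√5) := by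
    rw [← Int.cast_natCast, Zsqrtd.intCast_dvd]
    rintro ⟨-, h2⟩
    have h2' : (q : ℤ) ∣ 2 := h2
    exact hq2 (by exact_mod_cast h2')
  exact norm_ne_neg_pow_four hq hq4 h5 hγ ⟨A₁, A₂⟩ ⟨B₁, B₂⟩ (D := (d : ℤ)) (by exact_mod_cast hd0) key

/-! ### §3 Quadratic extensions: coordinates on `(1, w)` and the norm form `a² − βc²` -/

section Quadratic

variable {F E : Type*} [Field F] [Field E] [Algebra F E]

/-- In a quadratic extension `E/F` (`[E : F] = 2`) with `w ∉ F` there is an `F`-basis `(1, w)` of `E`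
(`(1, w)` is linearly independent: `s + tw = 0`, `t ≠ 0` would put `w = −s/t ∈ F`).
research route conditional on HC_CM; not a corollary; Q11.4-sentence-2 already refuted in dim ≥ 3. [folklore] -/
theorem exists_basis_one_pair (h2 : finrank F E = 2) {w : E} (hwF : w ∉ Set.range (algebraMap F E)) :
    ∃ b : Basis (Fin 2) F E, b 0 = 1 ∧ b 1 = w := by
  have hli : LinearIndependent F ![(1 : E), w] := by
    rw [LinearIndependent.pair_iff]
    intro s t hst
    by_cases ht : t = 0
    · subst ht
      rw [zero_smul, add_zero, Algebra.smul_def, mul_one, map_eq_zero] at hst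
      exact ⟨hst, rfl⟩
    · exfalso
      apply hwF
      refine ⟨-(s / t), ?_⟩
      rw [Algebra.smul_def, Algebra.smul_def, mul_one] at hst
      have ht' : algebraMap F E t ≠ 0 := (_root_.map_ne_zero _).mpr ht
      have hwt : w * algebraMap F E t = -(algebraMap F E s) := by linear_combination hst
      rw [map_neg, map_div₀, ← neg_div]
      exact (eq_div_of_mul_eq ht' hwt).symm
  refine ⟨basisOfLinearIndependentOfCardEqFinrank hli (by rw [Fintype.card_fin, h2]), ?_, ?_⟩
  · simp only [coe_basisOfLinearIndependentOfCardEqFinrank, Matrix.cons_val_zero]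
  · simp only [coe_basisOfLinearIndependentOfCardEqFinrank, Matrix.cons_val_one, Matrix.cons_val_fin_one]

/-- **Coordinates**: in a quadratic extension `E/F` (`[E : F] = 2`) with `w ∉ F`, every `y ∈ E` is `a + c·w`, `a, c ∈ F`.
research route conditional on HC_CM; not a corollary; Q11.4-sentence-2 already refuted in dim ≥ 3. [folklore] -/
theorem exists_coords (h2 : finrank F E = 2) {w : E} (hwF : w ∉ Set.range (algebraMap F E)) (y : E) :
    ∃ a c : F, y = algebraMap F E a + algebraMap F E c * w := by
  obtain ⟨b, hb0, hb1⟩ := exists_basis_one_pair h2 hwF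
  refine ⟨b.repr y 0, b.repr y 1, ?_⟩
  conv_lhs => rw [← b.sum_repr y]
  simp only [Fin.sum_univ_two, hb0, hb1, Algebra.smul_def, mul_one]

/-- **The norm form of a quadratic extension**: `[E : F] = 2`, `w² = β ∈ F`, `w ∉ F` ⇒ `N_{E/F}(a + c·w) = a² − βc²`
(the determinant of multiplication by `a + cw` on the basis `(1, w)`: `(a, βc; c, a)`).
research route conditional on HC_CM; not a corollary; Q11.4-sentence-2 already refuted in dim ≥ 3. [folklore] -/
theorem norm_quadratic (h2 : finrank F E = 2) {w : E} {β : F} (hw : w * w = algebraMap F E β)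
    (hwF : w ∉ Set.range (algebraMap F E)) (a c : F) :
    Algebra.norm F (algebraMap F E a + algebraMap F E c * w) = a ^ 2 - β * c ^ 2 := by
  classical
  obtain ⟨b, hb0, hb1⟩ := exists_basis_one_pair h2 hwF
  have e0 : (algebraMap F E a + algebraMap F E c * w) * b 0 = ∑ i, (![a, c] i) • b i := by
    simp only [Fin.sum_univ_two, hb0, hb1, Matrix.cons_val_zero, Matrix.cons_val_one,
      Matrix.cons_val_fin_one, Algebra.smul_def, mul_one]
  have e1 : (algebraMap F E a + algebraMap F E c * w) * b 1 = ∑ i, (![β * c, a] i) • b i := by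
    simp only [Fin.sum_univ_two, hb0, hb1, Matrix.cons_val_zero, Matrix.cons_val_one,
      Matrix.cons_val_fin_one, Algebra.smul_def, mul_one, map_mul]
    rw [add_mul, mul_assoc, hw]
    ring
  rw [Algebra.norm_eq_matrix_det b, Matrix.det_fin_two, Algebra.leftMulMatrix_eq_repr_mul,
    Algebra.leftMulMatrix_eq_repr_mul, Algebra.leftMulMatrix_eq_repr_mul, Algebra.leftMulMatrix_eq_repr_mul,
    e0, e1, b.repr_sum_self, b.repr_sum_self]
  simp only [Matrix.cons_val_zero, Matrix.cons_val_one, Matrix.cons_val_fin_one]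
  ring

/-- **`[F(w) : F] = 2`** for `w ∉ F` with `w² = β ∈ F` (the minimal polynomial divides `X² − β` and has degree `≥ 2`).
research route conditional on HC_CM; not a corollary; Q11.4-sentence-2 already refuted in dim ≥ 3. [folklore] -/
theorem finrank_adjoin_eq_two {w : E} {β : F} (hint : IsIntegral F w) (hw : w * w = algebraMap F E β)
    (hwF : w ∉ Set.range (algebraMap F E)) : finrank F F⟮w⟯ = 2 := by
  rw [adjoin.finrank hint]
  apply le_antisymm
  · have hp0 : (X ^ 2 - C β : F[X]) ≠ 0 := X_pow_sub_C_ne_zero two_pos _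
    have hpw : aeval w (X ^ 2 - C β : F[X]) = 0 := by
      simp only [map_sub, map_pow, aeval_X, aeval_C]
      rw [sq, hw, sub_self]
    have hdeg := minpoly.degree_le_of_ne_zero (A := F) (x := w) hp0 hpw
    rw [degree_X_pow_sub_C two_pos] at hdeg
    exact natDegree_le_iff_degree_le.mpr hdeg
  · exact (minpoly.two_le_natDegree_iff hint).mpr (by rintro ⟨r, hr⟩; exact hwF ⟨r, hr⟩)

end Quadratic

/-! ### §4 Number fields containing `√5` and `√(q(5+√5)/2)`: `−1` is not a norm -/

/-- **MAIN THEOREM (the `q`-adic obstruction, globally and elementarily)**: a number field `L ∋ s, w` with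
`s² = 5`, `2w² = q(5 + s)` (`q ≡ 3 (mod 4)` prime, `5` a non-residue mod `q`, `q` odd; `q = 3`: `L ⊇ ℚ(ζ₁₅)⁺`,
`q = 7`: `L ⊇` the real cyclic quartic field of conductor `35`) has **`N_{L/ℚ}(x) ≠ −1` for every `x ∈ L`** — so no
unit of `L` has norm `−1`.  (`N_{L/ℚ} = N_{F₁/ℚ} ∘ N_{F₂/F₁} ∘ N_{L/F₂}`, `F₁ = ℚ(s)`, `F₂ = F₁(w)`, `[F₂ : F₁] = 2`
as `N_{F₁/ℚ}(w²) = 5q²` is not a square; `N_{F₂/F₁}(a + cw) = a² − βc²`, `β = q(5+s)/2` (§3); §2.)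
research route conditional on HC_CM; not a corollary; Q11.4-sentence-2 already refuted in dim ≥ 3. [folklore] -/
theorem norm_ne_neg_one {L : Type*} [Field L] [NumberField L] {q : ℕ} (hq : q.Prime) (hq4 : q % 4 = 3)
    (h5 : ∀ u v : ZMod q, u ^ 2 = 5 * v ^ 2 → u = 0 ∧ v = 0) (hq2 : ¬ q ∣ 2)
    {s w : L} (hs : s ^ 2 = 5) (hw : 2 * w ^ 2 = q * (5 + s)) (x : L) :
    Algebra.norm ℚ x ≠ -1 := by
  classical
  intro hx
  have not_isSquare_five : ¬ IsSquare (5 : ℚ) := by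
    have h : ¬ IsSquare (5 : ℕ) := by
      rintro ⟨r, hr⟩
      have hr2 : r ≤ 2 := by nlinarith
      interval_cases r <;> omega
    intro h'
    rw [show (5 : ℚ) = ((5 : ℕ) : ℚ) by norm_num, Rat.isSquare_natCast_iff] at h'
    exact h h'
  have hsℚ : s ∉ Set.range (algebraMap ℚ L) := by
    rintro ⟨r, hr⟩
    apply not_isSquare_five
    have h1 : algebraMap ℚ L (r ^ 2) = algebraMap ℚ L 5 := by rw [map_pow, hr, hs, map_ofNat]
    exact ⟨r, by rw [← sq]; exact ((algebraMap ℚ L).injective h1).symm⟩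
  have hint : IsIntegral ℚ s := Algebra.IsIntegral.isIntegral s
  have hss : s * s = algebraMap ℚ L 5 := by rw [← sq, hs, map_ofNat]
  -- `F₁ = ℚ(s)`
  set F₁ : IntermediateField ℚ L := ℚ⟮s⟯ with hF₁
  have h2 : finrank ℚ F₁ = 2 := finrank_adjoin_eq_two hint hss hsℚ
  set s₁ : F₁ := AdjoinSimple.gen ℚ s with hs₁def
  have hs₁L : algebraMap F₁ L s₁ = s := AdjoinSimple.algebraMap_gen ℚ s
  have hs₁ : s₁ * s₁ = algebraMap ℚ F₁ 5 := by
    apply (algebraMap F₁ L).injective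
    rw [map_mul, hs₁L, ← IsScalarTower.algebraMap_apply ℚ F₁ L, hss]
  have hs₁' : s₁ * s₁ = (5 : F₁) := by rw [hs₁, map_ofNat]
  have hs₁ℚ : s₁ ∉ Set.range (algebraMap ℚ F₁) := by
    rintro ⟨r, hr⟩
    exact hsℚ ⟨r, by rw [IsScalarTower.algebraMap_apply ℚ F₁ L, hr, hs₁L]⟩
  -- `β = q(5 + s)/2 ∈ F₁`, in coordinates
  set β₁ : F₁ := algebraMap ℚ F₁ (5 * q / 2) + algebraMap ℚ F₁ (q / 2) * s₁ with hβ₁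
  have hww : w * w = algebraMap F₁ L β₁ := by
    rw [hβ₁, map_add, map_mul, hs₁L, ← IsScalarTower.algebraMap_apply ℚ F₁ L,
      ← IsScalarTower.algebraMap_apply ℚ F₁ L]
    simp only [eq_ratCast]
    push_cast
    linear_combination hw / 2
  have hwF₁ : w ∉ Set.range (algebraMap F₁ L) := by
    rintro ⟨z, hz⟩
    obtain ⟨x₁, x₂, hz'⟩ := exists_coords h2 hs₁ℚ z
    have hzz : z * z = β₁ := (algebraMap F₁ L).injective (by rw [map_mul, hz, hww])
    have hn1 : Algebra.norm ℚ z = x₁ ^ 2 - 5 * x₂ ^ 2 := by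
      rw [hz']; exact norm_quadratic h2 hs₁ hs₁ℚ x₁ x₂
    have hn2 : Algebra.norm ℚ β₁ = (5 * q / 2) ^ 2 - 5 * (q / 2) ^ 2 := norm_quadratic h2 hs₁ hs₁ℚ _ _
    have h3 : (x₁ ^ 2 - 5 * x₂ ^ 2) ^ 2 = 5 * (q : ℚ) ^ 2 := by
      have e := congrArg (Algebra.norm ℚ) hzz
      rw [map_mul, hn1, hn2] at e
      linear_combination e
    apply not_isSquare_five
    have hq0 : (q : ℚ) ≠ 0 := by exact_mod_cast hq.ne_zero
    refine ⟨(x₁ ^ 2 - 5 * x₂ ^ 2) / q, ?_⟩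
    rw [div_mul_div_comm, eq_div_iff (mul_ne_zero hq0 hq0)]
    linear_combination -h3
  -- `F₂ = F₁(w)`
  have hintw : IsIntegral F₁ w := (Algebra.IsIntegral.isIntegral (R := ℚ) w).tower_top
  set F₂ : IntermediateField F₁ L := F₁⟮w⟯ with hF₂
  have h2' : finrank F₁ F₂ = 2 := finrank_adjoin_eq_two hintw hww hwF₁
  set w₂ : F₂ := AdjoinSimple.gen F₁ w with hw₂def
  have hw₂L : algebraMap F₂ L w₂ = w := AdjoinSimple.algebraMap_gen F₁ w
  have hw₂ : w₂ * w₂ = algebraMap F₁ F₂ β₁ := by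
    apply (algebraMap F₂ L).injective
    rw [map_mul, hw₂L, ← IsScalarTower.algebraMap_apply F₁ F₂ L, hww]
  have hw₂F : w₂ ∉ Set.range (algebraMap F₁ F₂) := by
    rintro ⟨r, hr⟩
    exact hwF₁ ⟨r, by rw [IsScalarTower.algebraMap_apply F₁ F₂ L, hr, hw₂L]⟩
  -- transitivity of the norm
  have hN : Algebra.norm ℚ (Algebra.norm F₁ (Algebra.norm F₂ x)) = Algebra.norm ℚ x := by
    rw [Algebra.norm_norm (R := F₁) (S := F₂) (A := L), Algebra.norm_norm (R := ℚ) (S := F₁) (A := L)]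
  obtain ⟨a, c, hac⟩ := exists_coords h2' hw₂F (Algebra.norm F₂ x)
  obtain ⟨a₁, a₂, ha⟩ := exists_coords h2 hs₁ℚ a
  obtain ⟨c₁, c₂, hc⟩ := exists_coords h2 hs₁ℚ c
  set Y₁ : ℚ := a₁ ^ 2 + 5 * a₂ ^ 2 - (q : ℚ) / 2 * (5 * (c₁ ^ 2 + 5 * c₂ ^ 2) + 5 * (2 * c₁ * c₂)) with hY₁
  set Y₂ : ℚ := 2 * a₁ * a₂ - (q : ℚ) / 2 * ((c₁ ^ 2 + 5 * c₂ ^ 2) + 5 * (2 * c₁ * c₂)) with hY₂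
  have hy : Algebra.norm F₁ (Algebra.norm F₂ x) = algebraMap ℚ F₁ Y₁ + algebraMap ℚ F₁ Y₂ * s₁ := by
    rw [hac, norm_quadratic h2' hw₂ hw₂F a c, ha, hc, hβ₁, hY₁, hY₂]
    simp only [map_add, map_sub, map_mul, map_pow, map_div₀, map_natCast, map_ofNat]
    linear_combination (algebraMap ℚ F₁ a₂ ^ 2 - (q : F₁) / 2 * (2 * algebraMap ℚ F₁ c₁ * algebraMap ℚ F₁ c₂ +
      (5 + s₁) * algebraMap ℚ F₁ c₂ ^ 2)) * hs₁'
  have hfinal : Y₁ ^ 2 - 5 * Y₂ ^ 2 = -1 := by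
    have e := norm_quadratic h2 hs₁ hs₁ℚ Y₁ Y₂
    rw [← hy, hN, hx] at e
    exact e.symm
  exact rat_core hq hq4 h5 hq2 a₁ a₂ c₁ c₂ Y₁ Y₂ hY₁ hY₂ hfinal

end Summit.HodgeConjecture.Ring2WeilCoverage.QuarticNormObstruction

end
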